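import Literature.NumberTheory.Sieve.DrappeauDispersionS1Poisson
import Literature.NumberTheory.Sieve.DrappeauDispersionReciprocity
import HarnessLib

/-!
# Drappeau 2017, §5.5: the phase of the frequency sum `ℛ₁(q₀,n₀)` ((5.22)–(5.23), first steps)

Topic `Literature/NumberTheory/Sieve`, part of the formalisation of §5 of S. Drappeau, Proc. London
Math. Soc. (3) 114 (2017) 684–732 = arXiv:1504.05549 (Theorem 5.1 = the named fact
`Literature.NumberTheory.Sieve.Drappeau2017_theorem51`).  Everything here is PROVED; no definition
and no named fact is introduced.

§5.5 (arXiv p. 20): in `ℛ₁ = ∑ γγ ∑ ββ̄ ∑_{0<|h|≤H} (1/W) α̂(h/W) e(hμ/W)` "the residue class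
`μ mod W` satisfies `μ ≡ a₁ \overline{a₂n₀n_j} (q₀q_j)`", and by (5.22)
`μ/(q₀q₁q₂) ≡ a₁/(q₀q₁q₂a₂n₀n₁) + a₁ ((n₁−n₂)/q₀) \overline{q₁a₂n₀n₂}/(n₁q₂) − a₁\overline{q₀q₁q₂n₁}/(a₂n₀)
(mod 1)`.  For the tree's form of `ℛ₁` (`DrappeauDispersionS1Poisson`, where the class `μ` is the
unique `b < W` with `b n_j a₂ ≡ a₁ (q_j)`):

* `Drappeau2017.sum_filter_lcm_eq_ite` — the `b`-sum has exactly the one term `b = μ` when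
  `(n_j, q_j) = 1` and `n₁ ≡ n₂ ((q₁,q₂))`, and is empty otherwise;
* `Drappeau2017.fourierChar_mu_eq` — `e(hμ/(q₀q₁q₂))` as the product of the three phases of
  (5.22), with the inverses `u = \overline{q₁a₂n₀n₂} (n₁q₂)`, `v = \overline{q₀q₁q₂n₁} (a₂n₀)` made
  explicit (`cexp_reciprocity`);
* `Drappeau2017.bsum_fourierChar_eq` — the two combined: the `b`-sum of `ℛ₁(q₀,n₀)` in the
  variables of §5.5 equals the product of the three phases;
* `Drappeau2017.sum_Icc_ite_dvd_eq` — the remark that `W ∤ h` just means `h ≠ 0` once `W > H`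
  (the Taylor step `e(x) = 1 + O(|x|)` is the tree's `CircleMethodKernel.norm_fourierChar_sub_one_le`).

## References

* S. Drappeau, Proc. London Math. Soc. (3) 114 (2017) 684–732, arXiv:1504.05549, §5.5, (5.22).
  [cite: Drappeau2017, §5.5]
-/

noncomputable section

open Finset Real Complex
open scoped FourierTransform

namespace Literature.NumberTheory.Sieve

namespace Drappeau2017

/-- **The class `μ`.**  For `q₁, q₂ ≥ 1` and `a₁, a₂` units modulo `q₁`, `q₂`: there is `μ < [q₁,q₂]`
such that the `b < [q₁,q₂]` with `b n₁a₂ ≡ a₁ (q₁)`, `b n₂a₂ ≡ a₁ (q₂)` are exactly `{μ}` when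
`(n₁,q₁) = (n₂,q₂) = 1` and `n₁ ≡ n₂ ((q₁,q₂))` — in which case `q_j ∣ μ n_j a₂ − a₁` — and none
otherwise. [cite: Drappeau2017, §5.5] -/
theorem sum_filter_lcm_eq_ite {q₁ q₂ : ℕ} (hq₁ : 0 < q₁) (hq₂ : 0 < q₂) {a₁ a₂ : ℤ}
    (ha₁ : IsUnit (a₁ : ZMod q₁)) (ha₁' : IsUnit (a₁ : ZMod q₂)) (ha₂ : IsUnit (a₂ : ZMod q₁))
    (ha₂' : IsUnit (a₂ : ZMod q₂)) (n₁ n₂ : ℕ) :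
    ∃ μ : ℕ, μ < Nat.lcm q₁ q₂ ∧
      ((n₁.Coprime q₁ ∧ n₂.Coprime q₂ ∧ (n₁ : ZMod (Nat.gcd q₁ q₂)) = (n₂ : ZMod (Nat.gcd q₁ q₂))) →
        ((q₁ : ℤ) ∣ (μ : ℤ) * n₁ * a₂ - a₁) ∧ ((q₂ : ℤ) ∣ (μ : ℤ) * n₂ * a₂ - a₁)) ∧
      ∀ F : ℕ → ℂ,
        ∑ b ∈ (Finset.range (Nat.lcm q₁ q₂)).filter (fun b : ℕ =>
            (b : ZMod q₁) * ((n₁ : ZMod q₁) * (a₂ : ZMod q₁)) = (a₁ : ZMod q₁) ∧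
            (b : ZMod q₂) * ((n₂ : ZMod q₂) * (a₂ : ZMod q₂)) = (a₁ : ZMod q₂)), F b =
          if (n₁.Coprime q₁ ∧ n₂.Coprime q₂ ∧ (n₁ : ZMod (Nat.gcd q₁ q₂)) = (n₂ : ZMod (Nat.gcd q₁ q₂)))
            then F μ else 0 := by
  have hcard := card_range_lcm_filter_eq hq₁ hq₂ ha₁ ha₁' ha₂ ha₂' n₁ n₂
  by_cases hc : (n₁.Coprime q₁ ∧ n₂.Coprime q₂ ∧ (n₁ : ZMod (Nat.gcd q₁ q₂)) = (n₂ : ZMod (Nat.gcd q₁ q₂)))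
  · rw [if_pos hc] at hcard
    obtain ⟨μ, hμ⟩ := Finset.card_eq_one.1 hcard
    have hμmem : μ ∈ (Finset.range (Nat.lcm q₁ q₂)).filter (fun b : ℕ =>
        (b : ZMod q₁) * ((n₁ : ZMod q₁) * (a₂ : ZMod q₁)) = (a₁ : ZMod q₁) ∧
        (b : ZMod q₂) * ((n₂ : ZMod q₂) * (a₂ : ZMod q₂)) = (a₁ : ZMod q₂)) := by
      rw [hμ]; exact Finset.mem_singleton_self _
    rw [Finset.mem_filter, Finset.mem_range] at hμmem
    refine ⟨μ, hμmem.1, fun _ => ⟨?_, ?_⟩, fun F => ?_⟩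
    · rw [← ZMod.intCast_zmod_eq_zero_iff_dvd]
      push_cast
      rw [sub_eq_zero, mul_assoc]
      exact_mod_cast hμmem.2.1
    · rw [← ZMod.intCast_zmod_eq_zero_iff_dvd]
      push_cast
      rw [sub_eq_zero, mul_assoc]
      exact_mod_cast hμmem.2.2
    · rw [if_pos hc, hμ, Finset.sum_singleton]
  · rw [if_neg hc] at hcard
    refine ⟨0, Nat.lcm_pos hq₁ hq₂, fun h => absurd h hc, fun F => ?_⟩
    rw [if_neg hc, Finset.card_eq_zero.1 hcard, Finset.sum_empty]

/-- An integer representative of the inverse of a unit class is an inverse modulo `m`. [folklore] -/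
theorem dvd_val_inv_mul_sub_one {m : ℕ} (hm : 0 < m) {x : ℤ} (hx : IsUnit (x : ZMod m)) :
    (m : ℤ) ∣ (((x : ZMod m)⁻¹).val : ℤ) * x - 1 := by
  haveI : NeZero m := ⟨hm.ne'⟩
  rw [← ZMod.intCast_zmod_eq_zero_iff_dvd]
  push_cast
  rw [ZMod.natCast_zmod_val, ZMod.inv_mul_of_unit _ hx, sub_self]

/-- **Drappeau 2017, (5.22) for the class `μ`.**  In the notation of §5.5 (moduli `q₀q₁, q₀q₂` with
`(q₁,q₂) = 1`, integers `n₀n₁, n₀n₂` with `(n₁,n₂) = 1`, `n₁ ≡ n₂ (q₀)`), if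
`q₀q_j ∣ μ a₂n₀n_j − a₁` then
`e(hμ/(q₀q₁q₂)) = e(ha₁/(q₀q₁q₂a₂n₀n₁)) · e(ha₁tu/(n₁q₂)) · e(−ha₁v/(a₂n₀))`
with `t = (n₁−n₂)/q₀`, `u = \overline{q₁a₂n₀n₂} mod n₁q₂`, `v = \overline{q₀q₁q₂n₁} mod |a₂|n₀`
(integer representatives). [cite: Drappeau2017, §5.5, (5.22)] -/
theorem fourierChar_mu_eq {q₀ q₁ q₂ n₀ n₁ n₂ : ℕ} {a₁ a₂ μ : ℤ} (hq₀ : 0 < q₀) (hq₁ : 0 < q₁)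
    (hq₂ : 0 < q₂) (hn₀ : 0 < n₀) (hn₁ : 0 < n₁) (ha₂ : a₂ ≠ 0)
    (hq : Nat.Coprime q₁ q₂) (hn₁q : IsCoprime (n₁ : ℤ) (q₀ * q₁)) (hn₂ : IsCoprime (n₂ : ℤ) (n₁ * q₂))
    (hA : IsCoprime (a₂ * n₀) ((q₀ : ℤ) * q₁ * q₂ * n₁)) {t : ℤ} (ht : (n₁ : ℤ) - n₂ = q₀ * t)
    (hμ₁ : (q₀ : ℤ) * q₁ ∣ μ * a₂ * n₀ * n₁ - a₁) (hμ₂ : (q₀ : ℤ) * q₂ ∣ μ * a₂ * n₀ * n₂ - a₁)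
    (h : ℤ) :
    (𝐞 ((μ : ℝ) * h / ((q₀ : ℝ) * q₁ * q₂)) : ℂ) =
      (𝐞 ((h : ℝ) * a₁ / ((q₀ : ℝ) * q₁ * q₂ * a₂ * n₀ * n₁)) : ℂ) *
        (𝐞 ((h : ℝ) * a₁ * t * ((((q₁ : ℤ) * a₂ * n₀ * n₂ : ℤ) : ZMod (n₁ * q₂))⁻¹).val /
            ((n₁ : ℝ) * q₂)) : ℂ) *
        (𝐞 (-((h : ℝ) * a₁ * ((((q₀ : ℤ) * q₁ * q₂ * n₁ : ℤ) : ZMod (a₂.natAbs * n₀))⁻¹).val /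
            ((a₂ : ℝ) * n₀))) : ℂ) := by
  have hnq : 0 < n₁ * q₂ := Nat.mul_pos hn₁ hq₂
  have han : 0 < a₂.natAbs * n₀ := Nat.mul_pos (Int.natAbs_pos.2 ha₂) hn₀
  -- coprimalities
  have hq' : IsCoprime (q₂ : ℤ) q₁ := Nat.isCoprime_iff_coprime.2 hq.symm
  have h11 : IsCoprime (n₁ : ℤ) q₁ := hn₁q.of_mul_right_right
  have h12 : IsCoprime (n₁ : ℤ) a₂ := hA.of_mul_right_right.of_mul_left_left.symm
  have h13 : IsCoprime (n₁ : ℤ) n₀ := hA.of_mul_right_right.of_mul_left_right.symm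
  have h14 : IsCoprime (n₁ : ℤ) n₂ := hn₂.of_mul_right_left.symm
  have hAq₂ : IsCoprime (a₂ * n₀) (q₂ : ℤ) := hA.of_mul_right_left.of_mul_right_right
  have h22 : IsCoprime (q₂ : ℤ) a₂ := hAq₂.of_mul_left_left.symm
  have h23 : IsCoprime (q₂ : ℤ) n₀ := hAq₂.of_mul_left_right.symm
  have h24 : IsCoprime (q₂ : ℤ) n₂ := hn₂.of_mul_right_right.symm
  have hcopu : IsCoprime (((n₁ * q₂ : ℕ) : ℤ)) ((q₁ : ℤ) * a₂ * n₀ * n₂) := by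
    push_cast
    exact IsCoprime.mul_left (((h11.mul_right h12).mul_right h13).mul_right h14)
      (((hq'.mul_right h22).mul_right h23).mul_right h24)
  have hcopv : IsCoprime (((a₂.natAbs * n₀ : ℕ) : ℤ)) ((q₀ : ℤ) * q₁ * q₂ * n₁) := by
    push_cast
    rcases abs_choice a₂ with h' | h'
    · rw [h']; exact hA
    · rw [h', neg_mul]; exact hA.neg_left
  -- the inverses are inverses
  have hunit_u : IsUnit ((((q₁ : ℤ) * a₂ * n₀ * n₂ : ℤ) : ZMod (n₁ * q₂))) :=
    (ZMod.coe_int_isUnit_iff_isCoprime _ _).2 hcopu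
  have hunit_v : IsUnit ((((q₀ : ℤ) * q₁ * q₂ * n₁ : ℤ) : ZMod (a₂.natAbs * n₀))) :=
    (ZMod.coe_int_isUnit_iff_isCoprime _ _).2 hcopv
  have hu' : (n₁ : ℤ) * q₂ ∣
      ((((((q₁ : ℤ) * a₂ * n₀ * n₂ : ℤ) : ZMod (n₁ * q₂))⁻¹).val : ℕ) : ℤ) * q₁ * a₂ * n₀ * n₂ - 1 := by
    have h1 := dvd_val_inv_mul_sub_one hnq hunit_u
    rw [mul_assoc _ (q₁ : ℤ), mul_assoc _ ((q₁ : ℤ) * a₂), mul_assoc _ ((q₁ : ℤ) * a₂ * n₀)]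
    exact_mod_cast h1
  have hv' : a₂ * n₀ ∣
      ((((((q₀ : ℤ) * q₁ * q₂ * n₁ : ℤ) : ZMod (a₂.natAbs * n₀))⁻¹).val : ℕ) : ℤ) * q₀ * q₁ * q₂ * n₁ - 1 := by
    have h1 := dvd_val_inv_mul_sub_one han hunit_v
    rw [mul_assoc _ (q₀ : ℤ), mul_assoc _ ((q₀ : ℤ) * q₁), mul_assoc _ ((q₀ : ℤ) * q₁ * q₂),
      ← Int.natAbs_dvd, Int.natAbs_mul, Int.natAbs_natCast]
    exact_mod_cast h1
  -- (5.22)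
  have key := cexp_reciprocity (q₀ := (q₀ : ℤ)) (q₁ := (q₁ : ℤ)) (q₂ := (q₂ : ℤ)) (n₀ := (n₀ : ℤ))
    (n₁ := (n₁ : ℤ)) (n₂ := (n₂ : ℤ)) (by exact_mod_cast hq₀.ne') (by exact_mod_cast hq₁.ne')
    (by exact_mod_cast hq₂.ne') (by exact_mod_cast hn₀.ne') (by exact_mod_cast hn₁.ne') ha₂
    (Nat.isCoprime_iff_coprime.2 hq) hn₁q hn₂ hA ht hμ₁ hμ₂ hu' hv' h
  rw [Real.fourierChar_apply, Real.fourierChar_apply, Real.fourierChar_apply, Real.fourierChar_apply]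
  have e1 : (((2 * π * ((μ : ℝ) * h / ((q₀ : ℝ) * q₁ * q₂)) : ℝ) : ℂ) * Complex.I) =
      2 * Real.pi * Complex.I * (h * μ / ((((q₀ : ℕ) : ℤ) : ℂ) * ((q₁ : ℕ) : ℤ) * ((q₂ : ℕ) : ℤ))) := by
    push_cast; ring
  have e2 : (((2 * π * ((h : ℝ) * a₁ / ((q₀ : ℝ) * q₁ * q₂ * a₂ * n₀ * n₁)) : ℝ) : ℂ) * Complex.I) =
      2 * Real.pi * Complex.I * (h * a₁ / ((((q₀ : ℕ) : ℤ) : ℂ) * ((q₁ : ℕ) : ℤ) * ((q₂ : ℕ) : ℤ) *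
        a₂ * ((n₀ : ℕ) : ℤ) * ((n₁ : ℕ) : ℤ))) := by
    push_cast; ring
  have e3 : (((2 * π * ((h : ℝ) * a₁ * t *
      ((((((q₁ : ℤ) * a₂ * n₀ * n₂ : ℤ) : ZMod (n₁ * q₂))⁻¹).val : ℕ) : ℝ) / ((n₁ : ℝ) * q₂)) : ℝ) : ℂ) *
        Complex.I) =
      2 * Real.pi * Complex.I * (h * a₁ * t *
        (((((((q₁ : ℤ) * a₂ * n₀ * n₂ : ℤ) : ZMod (n₁ * q₂))⁻¹).val : ℕ) : ℤ) : ℂ) /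
          ((((n₁ : ℕ) : ℤ) : ℂ) * ((q₂ : ℕ) : ℤ))) := by
    push_cast; ring
  have e4 : (((2 * π * (-((h : ℝ) * a₁ *
      ((((((q₀ : ℤ) * q₁ * q₂ * n₁ : ℤ) : ZMod (a₂.natAbs * n₀))⁻¹).val : ℕ) : ℝ) /
        ((a₂ : ℝ) * n₀))) : ℝ) : ℂ) * Complex.I) =
      2 * Real.pi * Complex.I * (-(h * a₁ *
        (((((((q₀ : ℤ) * q₁ * q₂ * n₁ : ℤ) : ZMod (a₂.natAbs * n₀))⁻¹).val : ℕ) : ℤ) : ℂ) /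
          ((a₂ : ℂ) * ((n₀ : ℕ) : ℤ)))) := by
    push_cast; ring
  rw [e1, e2, e3, e4]
  exact key

/-! ### The frequencies `h ≡ 0 (W)`

(The Taylor step `|e(x) − 1| ≤ 2π|x|` of §5.5 is the tree's
`CircleMethodKernel.norm_fourierChar_sub_one_le` / `Literature.Analysis.Fourier.norm_fourierChar_sub_one_le`.) -/

/-- For `0 < |h| ≤ H < W` the frequency `h` is not a multiple of `W`: in the truncated frequency sum
the condition `W ∤ h` only removes `h = 0` once `W > H`. [folklore] -/
theorem not_dvd_of_abs_le_of_lt {W : ℕ} {H : ℕ} (hHW : H < W) {h : ℤ} (h0 : h ≠ 0)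
    (hh : h ∈ Finset.Icc (-(H : ℤ)) H) : ¬ ((W : ℤ) ∣ h) := by
  intro hd
  rw [Finset.mem_Icc] at hh
  have h1 := Int.le_of_dvd (abs_pos.2 h0) ((dvd_abs _ _).2 hd)
  have h2 : |h| ≤ H := abs_le.2 ⟨hh.1, hh.2⟩
  omega

/-- Conversely the multiples of `W` contribute nothing: for `W > H`,
`∑_{|h| ≤ H} 1_{W ∤ h} F(h) = ∑_{|h| ≤ H, h ≠ 0} F(h)`. [folklore] -/
theorem sum_Icc_ite_dvd_eq {W H : ℕ} (hHW : H < W) (F : ℤ → ℂ) :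
    ∑ h ∈ Finset.Icc (-(H : ℤ)) H, (if ((W : ℕ) : ℤ) ∣ h then 0 else F h) =
      ∑ h ∈ (Finset.Icc (-(H : ℤ)) H).filter (fun h : ℤ => h ≠ 0), F h := by
  rw [Finset.sum_filter]
  refine Finset.sum_congr rfl fun h hh => ?_
  by_cases h0 : h = 0
  · rw [if_pos (by rw [h0]; exact dvd_zero _), if_neg (not_not.2 h0)]
  · rw [if_neg (not_dvd_of_abs_le_of_lt hHW h0 hh), if_pos h0]

/-! ### The `b`-sum of `ℛ₁` in the variables of §5.5 -/

/-- **Drappeau 2017, §5.5: the phase `e(hμ/W)` of `ℛ₁(q₀,n₀)`.**  In the variables of §5.5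
(moduli `q₀q₁, q₀q₂` with `(q₁,q₂) = 1`, so `W = [q₀q₁,q₀q₂] = q₀q₁q₂`; integers `n₀n₁, n₀n₂` with
`(n₁,n₂) = (n₀,n₁) = 1`, `n₁ ≡ n₂ (q₀)`, `(n₀n_j, q₀q_j) = 1`; `(q₀q₁q₂, a₁a₂) = (n₁, a₂) = 1`), the
`b`-sum of the tree's `ℛ₁` (`DrappeauDispersionS1Poisson`) is the single phase `e(hμ/W)`, which by
(5.22) factors as
`e(ha₁/(q₀q₁q₂a₂n₀n₁)) · e(a₁h ((n₁−n₂)/q₀) \overline{q₁a₂n₀n₂}/(n₁q₂)) · e(−a₁h \overline{q₀q₁q₂n₁}/(a₂n₀))`.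
[cite: Drappeau2017, §5.5, (5.22)] -/
theorem bsum_fourierChar_eq {q₀ q₁ q₂ n₀ n₁ n₂ : ℕ} {a₁ a₂ : ℤ} (hq₀ : 0 < q₀) (hq₁ : 0 < q₁)
    (hq₂ : 0 < q₂) (hn₀ : 0 < n₀) (hn₁ : 0 < n₁) (ha₂ : a₂ ≠ 0)
    (hq : Nat.Coprime q₁ q₂) (hn : Nat.Coprime n₁ n₂) (hn₀₁ : Nat.Coprime n₀ n₁)
    (hc₁ : (n₀ * n₁).Coprime (q₀ * q₁)) (hc₂ : (n₀ * n₂).Coprime (q₀ * q₂))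
    (hmod : n₁ ≡ n₂ [MOD q₀]) (hcq : IsCoprime (((q₀ * q₁ * q₂ : ℕ)) : ℤ) (a₁ * a₂))
    (hcn₁ : IsCoprime (n₁ : ℤ) a₂) (h : ℤ) :
    ∑ b ∈ (Finset.range (Nat.lcm (q₀ * q₁) (q₀ * q₂))).filter (fun b : ℕ =>
        (b : ZMod (q₀ * q₁)) * ((((n₀ * n₁ : ℕ)) : ZMod (q₀ * q₁)) * (a₂ : ZMod (q₀ * q₁))) =
          (a₁ : ZMod (q₀ * q₁)) ∧
        (b : ZMod (q₀ * q₂)) * ((((n₀ * n₂ : ℕ)) : ZMod (q₀ * q₂)) * (a₂ : ZMod (q₀ * q₂))) =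
          (a₁ : ZMod (q₀ * q₂))),
        (𝐞 ((b : ℝ) * h / (Nat.lcm (q₀ * q₁) (q₀ * q₂) : ℕ)) : ℂ) =
      (𝐞 ((h : ℝ) * a₁ / ((q₀ : ℝ) * q₁ * q₂ * a₂ * n₀ * n₁)) : ℂ) *
        (𝐞 ((h : ℝ) * a₁ * ((((n₁ : ℤ) - n₂) / q₀ : ℤ)) *
          ((((((q₁ : ℤ) * a₂ * n₀ * n₂ : ℤ) : ZMod (n₁ * q₂))⁻¹).val : ℕ) : ℝ) /
            ((n₁ : ℝ) * q₂)) : ℂ) *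
        (𝐞 (-((h : ℝ) * a₁ *
          ((((((q₀ : ℤ) * q₁ * q₂ * n₁ : ℤ) : ZMod (a₂.natAbs * n₀))⁻¹).val : ℕ) : ℝ) /
            ((a₂ : ℝ) * n₀))) : ℂ) := by
  have hQ₁ : 0 < q₀ * q₁ := Nat.mul_pos hq₀ hq₁
  have hQ₂ : 0 < q₀ * q₂ := Nat.mul_pos hq₀ hq₂
  -- `W = q₀q₁q₂`, `(q₀q₁, q₀q₂) = q₀`
  have hW : Nat.lcm (q₀ * q₁) (q₀ * q₂) = q₀ * q₁ * q₂ := by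
    rw [Nat.lcm_mul_left, hq.lcm_eq_mul, mul_assoc]
  have hg : Nat.gcd (q₀ * q₁) (q₀ * q₂) = q₀ := by rw [Nat.gcd_mul_left, hq.gcd_eq_one, mul_one]
  -- units
  have hcq₁ : IsCoprime (((q₀ * q₁ : ℕ)) : ℤ) (a₁ * a₂) :=
    hcq.of_isCoprime_of_dvd_left (by exact_mod_cast Dvd.intro q₂ rfl)
  have hcq₂ : IsCoprime (((q₀ * q₂ : ℕ)) : ℤ) (a₁ * a₂) :=
    hcq.of_isCoprime_of_dvd_left (by exact_mod_cast (⟨q₁, by ring⟩ : q₀ * q₂ ∣ q₀ * q₁ * q₂))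
  obtain ⟨hu₁, hu₂⟩ := isUnit_of_isCoprime_mul hcq₁
  obtain ⟨hu₁', hu₂'⟩ := isUnit_of_isCoprime_mul hcq₂
  obtain ⟨μ, _, hμdvd, hsum⟩ := sum_filter_lcm_eq_ite hQ₁ hQ₂ hu₁ hu₁' hu₂ hu₂' (n₀ * n₁) (n₀ * n₂)
  -- the conditions hold
  have hcond : ((n₀ * n₁).Coprime (q₀ * q₁) ∧ (n₀ * n₂).Coprime (q₀ * q₂) ∧
      (((n₀ * n₁ : ℕ)) : ZMod (Nat.gcd (q₀ * q₁) (q₀ * q₂))) =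
        (((n₀ * n₂ : ℕ)) : ZMod (Nat.gcd (q₀ * q₁) (q₀ * q₂)))) := by
    refine ⟨hc₁, hc₂, ?_⟩
    rw [ZMod.natCast_eq_natCast_iff, hg]
    exact hmod.mul_left n₀
  rw [hsum, if_pos hcond]
  obtain ⟨hμ₁, hμ₂⟩ := hμdvd hcond
  -- `t`
  have hdvd : (q₀ : ℤ) ∣ (n₁ : ℤ) - n₂ := (Nat.modEq_iff_dvd.1 hmod.symm)
  have ht : (n₁ : ℤ) - n₂ = q₀ * (((n₁ : ℤ) - n₂) / q₀) := (Int.mul_ediv_cancel' hdvd).symm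
  -- hypotheses of `fourierChar_mu_eq`
  have hn₁q : IsCoprime (n₁ : ℤ) (q₀ * q₁) := by
    have := Nat.isCoprime_iff_coprime.2 (hc₁.coprime_dvd_left (dvd_mul_left n₁ n₀))
    push_cast at this; exact this
  have hn₂q₂ : IsCoprime (n₂ : ℤ) q₂ := by
    have h1 : n₂.Coprime q₂ :=
      (hc₂.coprime_dvd_left (dvd_mul_left n₂ n₀)).coprime_dvd_right (dvd_mul_left q₂ q₀)
    exact Nat.isCoprime_iff_coprime.2 h1
  have hn₂' : IsCoprime (n₂ : ℤ) (n₁ * q₂) :=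
    (Nat.isCoprime_iff_coprime.2 hn.symm).mul_right hn₂q₂
  have ha₂Q : IsCoprime a₂ ((q₀ : ℤ) * q₁ * q₂) := by
    have := hcq.of_mul_right_right.symm; push_cast at this; exact this
  have hn₀Q₁ : IsCoprime (n₀ : ℤ) (q₀ * q₁) := by
    have := Nat.isCoprime_iff_coprime.2 (hc₁.coprime_dvd_left (dvd_mul_right n₀ n₁))
    push_cast at this; exact this
  have hn₀q₂ : IsCoprime (n₀ : ℤ) q₂ := by
    have h1 : n₀.Coprime q₂ :=
      (hc₂.coprime_dvd_left (dvd_mul_right n₀ n₂)).coprime_dvd_right (dvd_mul_left q₂ q₀)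
    exact Nat.isCoprime_iff_coprime.2 h1
  have hn₀' : IsCoprime (n₀ : ℤ) ((q₀ : ℤ) * q₁ * q₂ * n₁) :=
    ((hn₀Q₁.mul_right hn₀q₂).mul_right (Nat.isCoprime_iff_coprime.2 hn₀₁))
  have hA : IsCoprime (a₂ * n₀) ((q₀ : ℤ) * q₁ * q₂ * n₁) :=
    (ha₂Q.mul_right hcn₁.symm).mul_left hn₀'
  have hμ₁' : (q₀ : ℤ) * q₁ ∣ μ * a₂ * n₀ * n₁ - a₁ := by
    have e : (μ : ℤ) * a₂ * n₀ * n₁ - a₁ = (μ : ℤ) * ((n₀ * n₁ : ℕ) : ℤ) * a₂ - a₁ := by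
      push_cast; ring
    rw [e]; exact_mod_cast hμ₁
  have hμ₂' : (q₀ : ℤ) * q₂ ∣ μ * a₂ * n₀ * n₂ - a₁ := by
    have e : (μ : ℤ) * a₂ * n₀ * n₂ - a₁ = (μ : ℤ) * ((n₀ * n₂ : ℕ) : ℤ) * a₂ - a₁ := by
      push_cast; ring
    rw [e]; exact_mod_cast hμ₂
  have key := fourierChar_mu_eq (a₁ := a₁) hq₀ hq₁ hq₂ hn₀ hn₁ ha₂ hq hn₁q hn₂' hA ht hμ₁' hμ₂' h
  rw [hW]
  have e : ((μ : ℕ) : ℝ) * h / ((q₀ * q₁ * q₂ : ℕ) : ℝ) = ((μ : ℤ) : ℝ) * h / ((q₀ : ℝ) * q₁ * q₂) := by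
    push_cast; ring
  rw [e, key]

end Drappeau2017

end Literature.NumberTheory.Sieve

end
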